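import Literature.Analysis.FluidPDE.NSHopfGalerkinLimit
import Literature.Analysis.FluidPDE.NSGalerkinTrajectory
import Literature.Analysis.FunctionSpaces.TorusClassicalNSGluing
import Literature.Analysis.FluidPDE.TorusWeakStrongUniqueness
import Literature.Analysis.FunctionSpaces.TorusAgmonExplicit
import Literature.Analysis.FunctionSpaces.TorusVectorParseval
import HarnessLib

/-!
# Uniform gradient bounds along Fourier–Galerkin trajectories pass to the classical solution on `T³`
(Hopf 1951 §4; Robinson–Rodrigo–Sadowski 2016, Thm. 4.4 with Thm. 6.10)

Analysis/FluidPDE proof file (theorems only; no definitions, no named facts, no `sorry`). A recurring step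
in Galerkin-based regularity arguments is the «passage of the bound»: an `N`-uniform bound on a spectral
norm of the Galerkin approximations `u_N` from `P_N u₀` is transported to the solution «by weak lower
semicontinuity» (Robinson–Rodrigo–Sadowski 2016, proof of Thm. 4.4, Step 4, p. 77; the same passage is
the last step of every «uniform-in-`N` Galerkin bound ⇒ global regularity» argument, e.g. RRS Thm. 6.8).
This file proves the classical-solution form of that passage on the flat unit torus `T³`, entirely from
the tree's Hopf–Galerkin pipeline and weak–strong uniqueness — no compactness argument is re-done:

* `isGalerkinMode_fourierTruncate` — `P_N` of an `L²`, weakly divergence-free field is a Galerkin mode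
  of order `N` (RRS (4.1), Lemma 2.9);
* `Torus.isHopfGalerkinScheme_of_isGalerkinTrajectory` — the field-level Galerkin trajectories of orders
  `0, 1, 2, …` from the truncations `P_n u₀` (`Torus.IsGalerkinTrajectory`, unforced) form a Hopf–Galerkin
  scheme for `(ν, 0, u₀)` (`IsHopfGalerkinScheme`; RRS Thm. 4.4 Steps 1–2, Lemma 4.1);
* `Torus.gradNormSq_le_of_tendsto_mFourierCoeff` — Parseval lower semicontinuity: if the Fourier
  coefficients of smooth fields `W j` converge modewise to those of a smooth `v` and `‖∇W j‖₂² ≤ C`, then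
  `‖∇v‖₂² ≤ C` (Grafakos 2014, Prop. 3.2.7 (3), through `Torus.hasSum_freq_mul_norm_sq_mFourierCoeff`);
* `Torus.IsClassicalNSSolutionOn.gradNormSq_le_of_galerkin_bound` — **the passage**: for `ν > 0`, a
  smooth divergence-free `u₀` and `C ∈ ℝ`, if EVERY field-level Galerkin trajectory from `P_N u₀`
  (every `N`) satisfies `‖∇U(t)‖₂² ≤ C` for all `t ≥ 0`, then every classical solution `(v, q)` of the
  unforced Navier–Stokes system on `[0, T) × T³` with `v 0 = u₀` satisfies `‖∇v(t)‖₂² ≤ C` on `[0, T)`.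
  Proof: the trajectories form a scheme; Hopf's limit (`IsHopfGalerkinScheme.exists_limitField`) gives a
  modewise-convergent subsequence at every `t ≥ 0` with an `L²` limit field, which is Leray–Hopf on
  every `[0, T′)` (`IsHopfGalerkinScheme.isLerayHopfOn_limit`); weak–strong uniqueness
  (`Torus.IsLerayHopfOn.ae_eq_of_isClassicalNSSolutionOn`, RRS Thm. 6.10) identifies it a.e. with
  `v(t)` for `t > 0`, so the Fourier coefficients agree (`Torus.mFourierCoeff_congr_ae`); at `t = 0`
  the truncations converge modewise by themselves; Parseval lower semicontinuity concludes.

The cell `ns-claims` (D-0090) used the `C158` instance of this theorem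
(`Summit.NavierStokesRegularity.NavierStokesRegularity.Theorems.Higgins2026Salvage.galerkinPassage_holds`);
this file is the vocabulary-free Literature form. Seat `ns-claims-salvage-p5` g4.

## References

* J. C. Robinson, J. L. Rodrigo, W. Sadowski, *The three-dimensional Navier–Stokes equations* (CUP 2016),
  §4.1 (4.1), Lemma 4.1, Thm. 4.4 (Steps 1–4, pp. 74–77), Thm. 6.10 (p. 106).
* E. Hopf, *Über die Anfangswertaufgabe für die hydrodynamischen Grundgleichungen*, Math. Nachr. 4
  (1951), 213–231, §4.
* L. Grafakos, *Classical Fourier Analysis*, 3rd ed. (2014), Prop. 3.2.7 (3).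
-/

noncomputable section

open Set Filter MeasureTheory Topology UnitAddTorus
open scoped ENNReal NNReal RealInnerProductSpace

namespace Literature.Analysis.FluidPDE

open FunctionSpaces FunctionSpaces.Torus

/-! ## Truncations are Galerkin modes; Galerkin trajectories form a Hopf–Galerkin scheme -/

section Scheme

variable {d : Type*} [Fintype d] [DecidableEq d]

/-- **`P_N` of an `L²`, weakly divergence-free torus field is a Galerkin mode of order `N`** (smooth,
divergence free, no Fourier modes outside `|k|² ≤ N²`). [cite: RobinsonRodrigoSadowski2016, §4.1 (4.1) and Lemma 2.9] -/
theorem isGalerkinMode_fourierTruncate {v : UnitAddTorus d → EuclideanSpace ℝ d} (hv : MemLp v 2 volume)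
    (hdiv : Torus.IsWeaklyDivFree v) (N : ℕ) : IsGalerkinMode N (Torus.fourierTruncate N v) := by
  refine ⟨Torus.isSmooth_fourierTruncate N v, Torus.isDivFree_fourierTruncate hv hdiv N, fun k hk => ?_⟩
  rw [Torus.mFourierCoeff_fourierTruncate (hv.integrable one_le_two) N k,
    if_neg (Torus.not_mem_freqBall.mpr hk)]

/-- **Field-level Galerkin trajectories of orders `n = 0, 1, 2, …` from the truncations `P_n u₀` form a
Hopf–Galerkin scheme for `(ν, 0, u₀)`** (`u₀ ∈ L²`, unforced): every clause of the scheme is a clause of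
`Torus.IsGalerkinTrajectory`; the data clause is `⟪P_n u₀, a⟫ = ⟪u₀, a⟫` for band-limited `a`
(`Torus.integral_inner_fourierTruncate_eq`), and `P_n u₀ → u₀` in `L²`
(`Torus.tendsto_eLpNorm_fourierTruncate_sub`). [cite: RobinsonRodrigoSadowski2016, Thm. 4.4 Steps 1–2, Lemma 4.1] -/
theorem Torus.isHopfGalerkinScheme_of_isGalerkinTrajectory {ν : ℝ}
    {u₀ : UnitAddTorus d → EuclideanSpace ℝ d} (hu₀ : MemLp u₀ 2 volume)
    {U : ℕ → ℝ → UnitAddTorus d → EuclideanSpace ℝ d} (hU : ∀ n, Torus.IsGalerkinTrajectory ν 0 n (U n))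
    (h0 : ∀ n, U n 0 = Torus.fourierTruncate n u₀) :
    IsHopfGalerkinScheme ν (0 : ℝ → UnitAddTorus d → EuclideanSpace ℝ d) u₀ id
      (0 : ℕ → ℝ → UnitAddTorus d → EuclideanSpace ℝ d) U where
  tendsto_order := tendsto_id
  smooth_force n := by
    show ContDiff ℝ _ (fun _ => (0 : EuclideanSpace ℝ d))
    exact contDiff_const
  tendsto_force T hT := by simp
  continuousOn n := (hU n).continuousOn
  isGalerkinMode n t ht := (hU n).isGalerkinMode t ht
  isWeaklyDivFree n t ht := (hU n).isWeaklyDivFree t ht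
  galerkin n a ha s t hs hst := (hU n).galerkin a ha s t hs hst
  energy_eq n s t hs hst := (hU n).energy_eq s t hs hst
  initial_inner n a ha := by
    rw [h0 n]
    exact Torus.integral_inner_fourierTruncate_eq hu₀ (ha.isSmooth.memLp 2)
      fun k hk => ha.2.2 k (Torus.not_mem_freqBall.mp hk)
  tendsto_initial := by
    have h := Torus.tendsto_eLpNorm_fourierTruncate_sub hu₀
    refine h.congr fun n => ?_
    simp only [h0 n]

/-- **Parseval lower semicontinuity for the gradient**: if the Fourier coefficients of smooth fields
`W j` converge modewise to those of a smooth field `v` and `‖∇W j‖₂² ≤ C` for all `j`, then `‖∇v‖₂² ≤ C`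
(every finite partial sum of `Σ_k 4π²|k|²‖v̂(k)‖²` is a limit of partial sums bounded by `C`).
[cite: Grafakos2014, Prop. 3.2.7 (3)] -/
theorem Torus.gradNormSq_le_of_tendsto_mFourierCoeff {v : UnitAddTorus d → EuclideanSpace ℝ d}
    (hv : Torus.IsSmooth v) {W : ℕ → UnitAddTorus d → EuclideanSpace ℝ d} (hW : ∀ j, Torus.IsSmooth (W j))
    {C : ℝ} (hC : ∀ j, Torus.gradNormSq (W j) ≤ C)
    (hc : ∀ k : d → ℤ, Tendsto (fun j => mFourierCoeff (EuclideanSpace.complexify ∘ W j) k) atTop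
      (𝓝 (mFourierCoeff (EuclideanSpace.complexify ∘ v) k))) :
    Torus.gradNormSq v ≤ C := by
  have hsum := Torus.hasSum_freq_mul_norm_sq_mFourierCoeff hv
  have hnn : ∀ w : UnitAddTorus d → EuclideanSpace ℝ d, ∀ k : d → ℤ,
      0 ≤ 4 * Real.pi ^ 2 * Torus.freqNormSq k * ‖mFourierCoeff (EuclideanSpace.complexify ∘ w) k‖ ^ 2 :=
    fun w k => by have := Torus.freqNormSq_nonneg k; positivity
  have hF : ∀ F : Finset (d → ℤ),
      ∑ k ∈ F, 4 * Real.pi ^ 2 * Torus.freqNormSq k * ‖mFourierCoeff (EuclideanSpace.complexify ∘ v) k‖ ^ 2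
        ≤ C := by
    intro F
    have hlim : Tendsto (fun j => ∑ k ∈ F, 4 * Real.pi ^ 2 * Torus.freqNormSq k *
        ‖mFourierCoeff (EuclideanSpace.complexify ∘ W j) k‖ ^ 2) atTop
        (𝓝 (∑ k ∈ F, 4 * Real.pi ^ 2 * Torus.freqNormSq k *
          ‖mFourierCoeff (EuclideanSpace.complexify ∘ v) k‖ ^ 2)) :=
      tendsto_finsetSum F fun k _ => (((hc k).norm.pow 2).const_mul _)
    refine le_of_tendsto' hlim fun j => ?_
    calc ∑ k ∈ F, 4 * Real.pi ^ 2 * Torus.freqNormSq k *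
          ‖mFourierCoeff (EuclideanSpace.complexify ∘ W j) k‖ ^ 2
        ≤ Torus.gradNormSq (W j) :=
          sum_le_hasSum F (fun k _ => hnn (W j) k) (Torus.hasSum_freq_mul_norm_sq_mFourierCoeff (hW j))
      _ ≤ C := hC j
  rw [← hsum.tsum_eq]
  exact hsum.summable.tsum_le_of_sum_le hF

end Scheme

/-! ## The passage of the bound on `T³` -/

section Passage

/-- **Uniform gradient bounds along all Galerkin trajectories pass to every classical solution**
(RRS 2016, Thm. 4.4 Step 4 «weak lower semicontinuity» + Thm. 6.10): for `ν > 0`, a smooth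
divergence-free `u₀` on `T³` and `C ∈ ℝ`, if every field-level Galerkin trajectory `U` of every order `N`
with `U 0 = P_N u₀` satisfies `‖∇U(t)‖₂² ≤ C` for all `t ≥ 0`, then every classical solution `(v, q)` of the
unforced Navier–Stokes system on `[0, T) × T³` with `v 0 = u₀` satisfies `‖∇v(t)‖₂² ≤ C` for every
`t ∈ [0, T)`. [cite: RobinsonRodrigoSadowski2016, Thm. 4.4 Step 4 (p. 77) and Thm. 6.10 (p. 106)] -/
theorem _root_.Literature.Analysis.FunctionSpaces.Torus.IsClassicalNSSolutionOn.gradNormSq_le_of_galerkin_bound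
    {ν : ℝ} (hν : 0 < ν) {u₀ : UnitAddTorus (Fin 3) → EuclideanSpace ℝ (Fin 3)} (hsm : Torus.IsSmooth u₀) (hdf : Torus.IsDivFree u₀) {C : ℝ}
    (hB : ∀ (N : ℕ) (U : ℝ → UnitAddTorus (Fin 3) → EuclideanSpace ℝ (Fin 3)), Torus.IsGalerkinTrajectory ν 0 N U →
      U 0 = Torus.fourierTruncate N u₀ → ∀ t : ℝ, 0 ≤ t → Torus.gradNormSq (U t) ≤ C)
    {T : ℝ} {v : ℝ → UnitAddTorus (Fin 3) → EuclideanSpace ℝ (Fin 3)} {q : ℝ → UnitAddTorus (Fin 3) → ℝ} (hv : Torus.IsClassicalNSSolutionOn (Ico 0 T) ν 0 v q)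
    (hv0 : v 0 = u₀) {t : ℝ} (ht : t ∈ Ico 0 T) :
    Torus.gradNormSq (v t) ≤ C := by
  have hL2 : MemLp u₀ 2 volume := hsm.memLp 2
  have hwdf : Torus.IsWeaklyDivFree u₀ := hdf.isWeaklyDivFree_holds hsm
  -- the Galerkin trajectories from `P_n u₀`
  have hex : ∀ n : ℕ, ∃ W : ℝ → UnitAddTorus (Fin 3) → EuclideanSpace ℝ (Fin 3),
      Torus.IsGalerkinTrajectory ν 0 n W ∧ W 0 = Torus.fourierTruncate n u₀ := fun n =>
    Torus.exists_isGalerkinTrajectory_of_isGalerkinMode hν.le (memLp_const 0)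
      (isGalerkinMode_fourierTruncate hL2 hwdf n)
  choose U hU hU0 using hex
  have hUB : ∀ n s, 0 ≤ s → Torus.gradNormSq (U n s) ≤ C := fun n s hs => hB n (U n) (hU n) (hU0 n) s hs
  rcases ht.1.eq_or_lt with h0 | htpos
  · -- `t = 0`: the truncations converge modewise to `u₀ = v 0`
    subst h0
    rw [hv0]
    refine Torus.gradNormSq_le_of_tendsto_mFourierCoeff hsm (W := fun n => U n 0)
      (fun n => ((hU n).isGalerkinMode 0 le_rfl).isSmooth) (fun n => hUB n 0 le_rfl) fun k => ?_
    refine tendsto_const_nhds.congr' ?_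
    have hev : ∀ᶠ n : ℕ in atTop, k ∈ Torus.freqBall n := by
      refine (eventually_ge_atTop ⌈Real.sqrt (Torus.freqNormSq k)⌉₊).mono fun n hn => ?_
      by_contra hkn
      have hlt := Torus.not_mem_freqBall.mp hkn
      have h1 : Real.sqrt (Torus.freqNormSq k) ≤ n := (Nat.le_ceil _).trans (by exact_mod_cast hn)
      have h2 : 0 ≤ Real.sqrt (Torus.freqNormSq k) := Real.sqrt_nonneg _
      nlinarith [Real.sq_sqrt (Torus.freqNormSq_nonneg k), h1, h2, mul_le_mul h1 h1 h2 (Nat.cast_nonneg n)]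
    filter_upwards [hev] with n hn
    rw [hU0 n, Torus.mFourierCoeff_fourierTruncate (hL2.integrable one_le_two) n k, if_pos hn]
  · -- `t > 0`: Hopf limit + weak–strong uniqueness
    have hS := Torus.isHopfGalerkinScheme_of_isGalerkinTrajectory hL2 hU hU0
    have hfm : AEStronglyMeasurable (Torus.stLift (0 : ℝ → UnitAddTorus (Fin 3) → EuclideanSpace ℝ (Fin 3)))
        (volume.restrict (Ioi 0 ×ˢ univ)) := by
      show AEStronglyMeasurable (fun _ => (0 : EuclideanSpace ℝ (Fin 3))) _
      exact aestronglyMeasurable_const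
    have hf₂ : ∀ T' : ℝ, 0 < T' → ∫⁻ s in Ioo 0 T', ∫⁻ x : UnitAddTorus (Fin 3), ‖(0 : ℝ → UnitAddTorus (Fin 3) → EuclideanSpace ℝ (Fin 3)) s x‖ₑ ^ 2 < ⊤ := by
      intro T' _; simp
    obtain ⟨φ, hφ, u, hum, huL2, hc⟩ := hS.exists_limitField hν.le hL2 hfm hf₂
    have hS' := hS.comp_strictMono hφ
    have hLH : Torus.IsLerayHopfOn t ν 0 u₀ u :=
      hS'.isLerayHopfOn_limit hν hL2 hwdf hfm hf₂ hum huL2 hc htpos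
    have hcl : Torus.IsClassicalNSSolutionOn (Icc 0 t) ν 0 v q :=
      hv.mono (Icc_subset_Ico_right ht.2) (uniqueDiffOn_Icc htpos)
    rw [← hv0] at hLH
    have hae : u t =ᵐ[volume] v t :=
      hLH.ae_eq_of_isClassicalNSSolutionOn hcl (convex_Icc 0 t) subset_rfl hν.le htpos t ⟨htpos, le_rfl⟩
    have hvs : Torus.IsSmooth (v t) := hv.smooth_velocity.isSmooth_slice ht
    refine Torus.gradNormSq_le_of_tendsto_mFourierCoeff hvs (W := fun j => U (φ j) t)
      (fun j => ((hU (φ j)).isGalerkinMode t ht.1).isSmooth) (fun j => hUB (φ j) t ht.1) fun k => ?_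
    have hk := hc t ht.1 k
    rwa [Torus.mFourierCoeff_congr_ae (hae.fun_comp EuclideanSpace.complexify) k] at hk

/-- **The whole-line form**: under the same hypotheses a classical solution on `[0, ∞) × T³` with
`v 0 = u₀` has `‖∇v(t)‖₂² ≤ C` for every `t ≥ 0`. [cite: RobinsonRodrigoSadowski2016, Thm. 4.4 Step 4 and Thm. 6.10] -/
theorem _root_.Literature.Analysis.FunctionSpaces.Torus.IsClassicalNSSolutionOn.gradNormSq_le_of_galerkin_bound_Ici
    {ν : ℝ} (hν : 0 < ν) {u₀ : UnitAddTorus (Fin 3) → EuclideanSpace ℝ (Fin 3)} (hsm : Torus.IsSmooth u₀) (hdf : Torus.IsDivFree u₀) {C : ℝ}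
    (hB : ∀ (N : ℕ) (U : ℝ → UnitAddTorus (Fin 3) → EuclideanSpace ℝ (Fin 3)), Torus.IsGalerkinTrajectory ν 0 N U →
      U 0 = Torus.fourierTruncate N u₀ → ∀ t : ℝ, 0 ≤ t → Torus.gradNormSq (U t) ≤ C)
    {v : ℝ → UnitAddTorus (Fin 3) → EuclideanSpace ℝ (Fin 3)} {q : ℝ → UnitAddTorus (Fin 3) → ℝ} (hv : Torus.IsClassicalNSSolutionOn (Ici 0) ν 0 v q)
    (hv0 : v 0 = u₀) {t : ℝ} (ht : 0 ≤ t) :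
    Torus.gradNormSq (v t) ≤ C :=
  (hv.mono (Ico_subset_Ici_self : Ico 0 (t + 1) ⊆ Ici 0) (uniqueDiffOn_Ico 0 (t + 1))).gradNormSq_le_of_galerkin_bound
    hν hsm hdf hB hv0 ⟨ht, by linarith⟩

end Passage

end Literature.Analysis.FluidPDE

end
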